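import Mathlib
import Literature.Computability.AlgebraicComplexity.ArithCircuitProofs
import Literature.Barriers.ValiantsHypothesis.MonotoneGapParseTrees

/-!
# Crux `DivisionGap.PerDivisionHard` (stmt-ValiantsHypothesis-5065), line `pair-descent-jss-endpoint` —
stub `stub_jssContraction`, part A: the monomial contraction of a polynomial over `ℝ≥0`

Semantic half of the Jukna–Seiwert–Sergeev contraction lemma (JuknaSeiwertSergeev2022, Lemma 2;
Jukna, *Tropical Circuit Complexity* 2023, Lemma 6.16, Claims 6.17–6.18, Remark 6.19): for a
polynomial `p` let `gcdVec p` be the coordinatewise minimum of its exponent vectors (the largest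
monomial `x^g` dividing every monomial of `p`) and `contract p := p / x^{gcdVec p}` (Mathlib's
`MvPolynomial.divMonomial`).  Then

* `monomial_gcdVec_mul_contract` : `p = x^{gcdVec p} · contract p` (any commutative semiring);
* `contract_C`, `contract_one`, `contract_X`, `contract_monomial_one` : inputs contract to constants;
* over `ℝ≥0` (no cancellation, no zero divisors — `JerrumSnir.support_add_eq/support_mul_eq`):
  `contract_mul` : `contract (p q) = contract p · contract q`,
  `contract_smul` : `contract (c • p) = c • contract p`,
  `contract_add_smul` : `contract (c • p + d • q) = c • x^{δ₁} contract p + d • x^{δ₂} contract q`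
  with `δᵢ = gcdVec(operand) - gcdVec(sum)` (valid in all degenerate cases), and
  `contract_monomial_mul` : `contract (x^u · f) = contract f`;
* `gcdVec_apply_le_totalDegree` : the entries of `gcdVec p` are at most `totalDegree p`;
* `totalDegree_getD_gateValues_le` / `totalDegree_operand_eval_le` : in a fan-in-two circuit
  (the tree's `ArithCircuit`, any nontrivial commutative semiring) the value of gate `j` has total
  degree `≤ 2^(j+1)` and every operand read after `s` gates has total degree `≤ 2^s` — so every
  gcd vector met while contracting a size-`s` circuit has entries `< 2^(s+1)`.

These are the gate-by-gate rules turning a monotone circuit for `x^u · f` into one for `contract f`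
(parts B, C of this stub).  Helper namespace `JssContraction`.
-/

noncomputable section

-- `Summit.ValiantsHypothesis.ValiantsHypothesis.…` is the tree's mandated single-conjunct layout
-- (Sub = Summit), so the duplicated namespace component is intended.
set_option linter.dupNamespace false

namespace Summit.ValiantsHypothesis.ValiantsHypothesis.Theorems.DivisionGapPerDivisionHard

open MvPolynomial Literature.Computability.AlgebraicComplexity ArithCircuit
open Literature.Barriers.ValiantsHypothesis
open scoped NNReal Pointwise

namespace JssContraction

variable {σ : Type*} {R : Type*} [CommSemiring R]

/-! ### The gcd vector of a finite set of exponent vectors -/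

/-- The coordinatewise minimum of a finite set of exponent vectors (`0` for the empty set):
the exponent of the largest monomial dividing all `x^m`, `m ∈ S`. [folklore] -/
def finsetGcd (S : Finset (σ →₀ ℕ)) : σ →₀ ℕ :=
  if h : S.Nonempty then S.inf' h id else 0

/-- `finsetGcd S` is a lower bound of `S`. [folklore] -/
theorem finsetGcd_le_of_mem {S : Finset (σ →₀ ℕ)} {m : σ →₀ ℕ} (hm : m ∈ S) : finsetGcd S ≤ m := by
  unfold finsetGcd
  rw [dif_pos ⟨m, hm⟩]
  exact Finset.inf'_le id hm

/-- `finsetGcd S` is the greatest lower bound of a nonempty `S`. [folklore] -/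
theorem le_finsetGcd {S : Finset (σ →₀ ℕ)} (hS : S.Nonempty) {g : σ →₀ ℕ} (h : ∀ m ∈ S, g ≤ m) :
    g ≤ finsetGcd S := by
  unfold finsetGcd
  rw [dif_pos hS]
  exact Finset.le_inf' hS id h

/-- Each coordinate of `finsetGcd S` is attained by a member of the nonempty set `S`. [folklore] -/
theorem exists_mem_finsetGcd_apply_eq {S : Finset (σ →₀ ℕ)} (hS : S.Nonempty) (v : σ) :
    ∃ m ∈ S, finsetGcd S v = m v := by
  unfold finsetGcd
  rw [dif_pos hS, Finset.apply_inf'_eq_inf'_comp hS (f := id) (fun f : σ →₀ ℕ => f v)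
    (fun x y => Finsupp.inf_apply x y v)]
  exact Finset.exists_mem_eq_inf' hS ((fun f : σ →₀ ℕ => f v) ∘ id)

/-- The gcd vector of a singleton. [folklore] -/
theorem finsetGcd_singleton (m : σ →₀ ℕ) : finsetGcd ({m} : Finset (σ →₀ ℕ)) = m := by
  unfold finsetGcd
  rw [dif_pos (Finset.singleton_nonempty m)]
  exact Finset.inf'_singleton id

/-- The gcd vector of a Minkowski sum of nonempty sets is the sum of the gcd vectors
(coordinatewise: the minimum of a sumset is the sum of the minima). [folklore] -/
theorem finsetGcd_add [DecidableEq σ] {A B : Finset (σ →₀ ℕ)} (hA : A.Nonempty) (hB : B.Nonempty) :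
    finsetGcd (A + B) = finsetGcd A + finsetGcd B := by
  apply le_antisymm
  · refine Finsupp.le_def.mpr fun v => ?_
    obtain ⟨a, ha, hav⟩ := exists_mem_finsetGcd_apply_eq hA v
    obtain ⟨b, hb, hbv⟩ := exists_mem_finsetGcd_apply_eq hB v
    have h := Finsupp.le_def.mp (finsetGcd_le_of_mem (Finset.add_mem_add ha hb)) v
    rw [Finsupp.add_apply] at h ⊢
    rw [hav, hbv]
    exact h
  · refine le_finsetGcd (hA.add hB) fun m hm => ?_
    obtain ⟨a, ha, b, hb, rfl⟩ := Finset.mem_add.mp hm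
    exact add_le_add (finsetGcd_le_of_mem ha) (finsetGcd_le_of_mem hb)

/-! ### The gcd vector and the contraction of a polynomial -/

/-- `gcdVec p`: the coordinatewise minimum of the exponent vectors of `p` (`0` for `p = 0`), i.e.
`x^{gcdVec p}` is the largest monomial dividing every monomial of `p`
(Jukna 2023, §6.3, before Lemma 6.16). [folklore] -/
def gcdVec (p : MvPolynomial σ R) : σ →₀ ℕ :=
  finsetGcd p.support

/-- `contract p := p / x^{gcdVec p}`, the contraction `[p]` of Jukna–Seiwert–Sergeev
(Mathlib's exact monomial division `MvPolynomial.divMonomial`). [folklore] -/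
def contract (p : MvPolynomial σ R) : MvPolynomial σ R :=
  p.divMonomial (gcdVec p)

/-- `gcdVec 0 = 0`. [folklore] -/
@[simp] theorem gcdVec_zero : gcdVec (0 : MvPolynomial σ R) = 0 := by simp [gcdVec, finsetGcd]

/-- `gcdVec p ≤ m` for every monomial `x^m` of `p`. [folklore] -/
theorem gcdVec_le_of_mem_support {p : MvPolynomial σ R} {m : σ →₀ ℕ} (hm : m ∈ p.support) :
    gcdVec p ≤ m :=
  finsetGcd_le_of_mem hm

/-- A common lower bound of the exponents of `p ≠ 0` is below `gcdVec p`. [folklore] -/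
theorem le_gcdVec {p : MvPolynomial σ R} (hp : p ≠ 0) {g : σ →₀ ℕ} (h : ∀ m ∈ p.support, g ≤ m) :
    g ≤ gcdVec p :=
  le_finsetGcd (support_nonempty.mpr hp) h

/-- Polynomials with the same support have the same gcd vector. [folklore] -/
theorem gcdVec_congr_support {p q : MvPolynomial σ R} (h : p.support = q.support) :
    gcdVec p = gcdVec q :=
  congrArg finsetGcd h

/-- Monotonicity: if `p ≠ 0` and `supp p ⊆ supp q` then `gcdVec q ≤ gcdVec p`. [folklore] -/
theorem gcdVec_le_gcdVec_of_support_subset {p q : MvPolynomial σ R} (hp : p ≠ 0)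
    (h : p.support ⊆ q.support) : gcdVec q ≤ gcdVec p :=
  le_gcdVec hp fun _ hm => gcdVec_le_of_mem_support (h hm)

/-- The gcd vector of a nonzero term `c x^u` is `u`. [folklore] -/
theorem gcdVec_monomial (u : σ →₀ ℕ) {c : R} (hc : c ≠ 0) :
    gcdVec (monomial u c : MvPolynomial σ R) = u := by
  classical
  unfold gcdVec
  rw [support_monomial, if_neg hc]
  exact finsetGcd_singleton u

/-- The gcd vector of a constant is `0`. [folklore] -/
@[simp] theorem gcdVec_C (c : R) : gcdVec (C c : MvPolynomial σ R) = 0 := by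
  by_cases hc : c = 0
  · rw [hc, C_0]
    exact gcdVec_zero
  · exact gcdVec_monomial 0 hc

/-- Each entry of `gcdVec p` is at most the total degree of `p`. [folklore] -/
theorem gcdVec_apply_le_totalDegree (p : MvPolynomial σ R) (v : σ) : gcdVec p v ≤ p.totalDegree := by
  by_cases hp : p = 0
  · simp [hp]
  obtain ⟨m, hm⟩ := support_nonempty.mpr hp
  calc gcdVec p v ≤ m v := Finsupp.le_def.mp (gcdVec_le_of_mem_support hm) v
    _ ≤ degreeOf v p := monomial_le_degreeOf v hm
    _ ≤ totalDegree p := degreeOf_le_totalDegree p v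

/-- No monomial of `p` survives reduction modulo `x^{gcdVec p}`. [folklore] -/
theorem modMonomial_gcdVec (p : MvPolynomial σ R) : p.modMonomial (gcdVec p) = 0 := by
  ext m
  rw [coeff_zero]
  by_cases h : gcdVec p ≤ m
  · exact coeff_modMonomial_of_le p h
  · rw [coeff_modMonomial_of_not_le p h]
    by_contra hne
    exact h (gcdVec_le_of_mem_support (mem_support_iff.mpr hne))

/-- **Factorisation** `p = x^{gcdVec p} · contract p` (Jukna 2023, §6.3). [folklore] -/
theorem monomial_gcdVec_mul_contract (p : MvPolynomial σ R) :
    monomial (gcdVec p) 1 * contract p = p := by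
  have h := divMonomial_add_modMonomial p (gcdVec p)
  rwa [modMonomial_gcdVec, add_zero] at h

/-- `contract 0 = 0`. [folklore] -/
@[simp] theorem contract_zero : contract (0 : MvPolynomial σ R) = 0 :=
  zero_divMonomial _

/-- Constants are their own contraction. [folklore] -/
@[simp] theorem contract_C (c : R) : contract (C c : MvPolynomial σ R) = C c := by
  rw [contract, gcdVec_C]
  exact divMonomial_zero _

/-- `contract 1 = 1`. [folklore] -/
@[simp] theorem contract_one : contract (1 : MvPolynomial σ R) = 1 := by
  rw [← C_1]
  exact contract_C 1

/-- A monic monomial contracts to `1`. [folklore] -/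
@[simp] theorem contract_monomial_one [Nontrivial R] (u : σ →₀ ℕ) :
    contract (monomial u (1 : R)) = 1 := by
  rw [contract, gcdVec_monomial u one_ne_zero]
  exact divMonomial_monomial u

/-- A variable contracts to `1`. [folklore] -/
@[simp] theorem contract_X [Nontrivial R] (v : σ) : contract (X v : MvPolynomial σ R) = 1 :=
  contract_monomial_one (Finsupp.single v 1)

/-- Monomial division commutes with scalars. [folklore] -/
theorem smul_divMonomial (c : R) (p : MvPolynomial σ R) (g : σ →₀ ℕ) :
    (c • p).divMonomial g = c • p.divMonomial g := by
  ext m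
  simp only [coeff_divMonomial, coeff_smul]

/-- Dividing by a monomial BELOW the gcd vector: `p / x^g = x^{gcdVec p - g} · contract p` for
`g ≤ gcdVec p`. [folklore] -/
theorem divMonomial_eq_of_le_gcdVec {p : MvPolynomial σ R} {g : σ →₀ ℕ} (hg : g ≤ gcdVec p) :
    p.divMonomial g = monomial (gcdVec p - g) 1 * contract p := by
  have h1 : monomial (gcdVec p) (1 : R) = monomial g 1 * monomial (gcdVec p - g) 1 := by
    rw [monomial_mul, one_mul, add_tsub_cancel_of_le hg]
  calc p.divMonomial g
      = (monomial g 1 * (monomial (gcdVec p - g) 1 * contract p)).divMonomial g := by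
        rw [← mul_assoc, ← h1, monomial_gcdVec_mul_contract]
    _ = monomial (gcdVec p - g) 1 * contract p := divMonomial_monomial_mul _ _

/-! ### Over `ℝ≥0`: contraction through sum and product gates -/

/-- Over `ℝ≥0` a nonzero scalar does not change the gcd vector. [folklore] -/
theorem gcdVec_smul {c : ℝ≥0} (hc : c ≠ 0) (p : MvPolynomial σ ℝ≥0) : gcdVec (c • p) = gcdVec p :=
  gcdVec_congr_support (JerrumSnir.support_smul_eq hc p)

/-- **Scalar gates**: `contract (c • p) = c • contract p` over `ℝ≥0` (also for `c = 0`). [folklore] -/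
theorem contract_smul (c : ℝ≥0) (p : MvPolynomial σ ℝ≥0) : contract (c • p) = c • contract p := by
  by_cases hc : c = 0
  · simp [hc]
  rw [contract, contract, smul_divMonomial, gcdVec_smul hc]

/-- **Sum gates** (Jukna 2023, Claim 6.17, sum case): with `g := gcdVec (c • p + d • q)`,
`contract (c • p + d • q) = c • (x^{gcdVec p - g} contract p) + d • (x^{gcdVec q - g} contract q)`
over `ℝ≥0`; valid also when a coefficient or an operand vanishes. [folklore] -/
theorem contract_add_smul (c d : ℝ≥0) (p q : MvPolynomial σ ℝ≥0) :
    contract (c • p + d • q) =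
      c • (monomial (gcdVec p - gcdVec (c • p + d • q)) 1 * contract p) +
        d • (monomial (gcdVec q - gcdVec (c • p + d • q)) 1 * contract q) := by
  classical
  set g := gcdVec (c • p + d • q) with hg
  have key : ∀ (c' : ℝ≥0) (p' : MvPolynomial σ ℝ≥0),
      (c' • p').support ⊆ (c • p + d • q).support →
      (c' • p').divMonomial g = c' • (monomial (gcdVec p' - g) 1 * contract p') := by
    intro c' p' hsub
    by_cases hc : c' = 0
    · simp [hc]
    by_cases hp : p' = 0
    · simp [hp]
    rw [smul_divMonomial, divMonomial_eq_of_le_gcdVec]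
    refine gcdVec_le_gcdVec_of_support_subset hp ?_
    rwa [JerrumSnir.support_smul_eq hc] at hsub
  have hp : (c • p).support ⊆ (c • p + d • q).support := by
    rw [JerrumSnir.support_add_eq]; exact Finset.subset_union_left
  have hq : (d • q).support ⊆ (c • p + d • q).support := by
    rw [JerrumSnir.support_add_eq]; exact Finset.subset_union_right
  rw [contract, ← hg, add_divMonomial, key c p hp, key d q hq]

/-- Over `ℝ≥0` the gcd vector is additive on products of nonzero polynomials
(`supp (p q) = supp p + supp q`). [folklore] -/
theorem gcdVec_mul {p q : MvPolynomial σ ℝ≥0} (hp : p ≠ 0) (hq : q ≠ 0) :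
    gcdVec (p * q) = gcdVec p + gcdVec q := by
  classical
  unfold gcdVec
  rw [JerrumSnir.support_mul_eq]
  exact finsetGcd_add (support_nonempty.mpr hp) (support_nonempty.mpr hq)

/-- **Product gates** (Jukna 2023, Claim 6.17, product case): `contract (p q) = contract p · contract q`
over `ℝ≥0`. [folklore] -/
theorem contract_mul (p q : MvPolynomial σ ℝ≥0) : contract (p * q) = contract p * contract q := by
  by_cases hp : p = 0
  · simp [hp]
  by_cases hq : q = 0
  · simp [hq]
  have h2 : p * q = monomial (gcdVec p + gcdVec q) 1 * (contract p * contract q) := by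
    conv_lhs => rw [← monomial_gcdVec_mul_contract p, ← monomial_gcdVec_mul_contract q]
    rw [mul_mul_mul_comm, monomial_mul, one_mul]
  show (p * q).divMonomial (gcdVec (p * q)) = contract p * contract q
  rw [gcdVec_mul hp hq, h2, ← gcdVec_mul hp hq]
  exact divMonomial_monomial_mul _ _

/-- **Monomial cofactors contract away**: `contract (x^u · f) = contract f` over `ℝ≥0`
(Jukna 2023, Remark 6.19). [folklore] -/
theorem contract_monomial_mul (u : σ →₀ ℕ) (f : MvPolynomial σ ℝ≥0) :
    contract (monomial u 1 * f) = contract f := by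
  rw [contract_mul, contract_monomial_one, one_mul]

/-- The gcd vector of `x^u · f` is `u + gcdVec f` for `f ≠ 0` over `ℝ≥0`. [folklore] -/
theorem gcdVec_monomial_mul (u : σ →₀ ℕ) {f : MvPolynomial σ ℝ≥0} (hf : f ≠ 0) :
    gcdVec (monomial u 1 * f) = u + gcdVec f := by
  rw [gcdVec_mul (monomial_eq_zero.not.mpr one_ne_zero) hf, gcdVec_monomial u one_ne_zero]

/-- The entries of `gcdVec f` are at most the total degree of any monomial multiple `x^u · f`
over `ℝ≥0`. [folklore] -/
theorem gcdVec_apply_le_totalDegree_monomial_mul (u : σ →₀ ℕ) (f : MvPolynomial σ ℝ≥0) (v : σ) :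
    gcdVec f v ≤ (monomial u 1 * f).totalDegree := by
  by_cases hf : f = 0
  · simp [hf]
  have h1 : gcdVec f v ≤ gcdVec (monomial u 1 * f) v := by
    rw [gcdVec_monomial_mul u hf, Finsupp.add_apply]
    exact Nat.le_add_left _ _
  exact h1.trans (gcdVec_apply_le_totalDegree _ v)

/-! ### Degree growth in fan-in-two circuits -/

/-- A list sum has total degree at most any common bound of its summands. [folklore] -/
theorem totalDegree_list_sum_le {l : List (MvPolynomial σ R)} {D : ℕ}
    (h : ∀ p ∈ l, p.totalDegree ≤ D) : l.sum.totalDegree ≤ D := by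
  induction l with
  | nil => simp
  | cons p l ih =>
    rw [List.sum_cons]
    exact (totalDegree_add p l.sum).trans (max_le (h p (by simp)) (ih fun q hq => h q (by simp [hq])))

/-- A gate of fan-in at most two at most doubles a degree bound `D` of its operands. [folklore] -/
theorem totalDegree_gate_eval_le {vals : List (MvPolynomial σ R)} {D : ℕ} {g : Gate R σ}
    (hg : g.fanIn ≤ 2) (h : ∀ u ∈ g.args, (u.eval vals).totalDegree ≤ D) :
    (g.eval vals).totalDegree ≤ 2 * D := by
  cases g with
  | sum args =>
    refine (totalDegree_list_sum_le (D := D) fun p hp => ?_).trans (Nat.le_mul_of_pos_left D two_pos)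
    obtain ⟨a, ha, rfl⟩ := List.mem_map.mp hp
    exact (totalDegree_smul_le a.1 _).trans (h a.2 (List.mem_map.mpr ⟨a, ha, rfl⟩))
  | prod args =>
    refine (totalDegree_list_prod _).trans ?_
    have hlen : args.length ≤ 2 := by simpa [Gate.fanIn, Gate.args] using hg
    have hall : ∀ x ∈ args.map (fun u => (u.eval vals).totalDegree), x ≤ D := by
      intro x hx
      obtain ⟨u, hu, rfl⟩ := List.mem_map.mp hx
      exact h u hu
    calc (List.map totalDegree (List.map (fun u => u.eval vals) args)).sum
        = (args.map (fun u => (u.eval vals).totalDegree)).sum := by rw [List.map_map]; rfl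
      _ ≤ (args.map (fun u => (u.eval vals).totalDegree)).length • D :=
          List.sum_le_card_nsmul _ _ hall
      _ ≤ 2 * D := by
          rw [List.length_map, smul_eq_mul]
          exact Nat.mul_le_mul_right D hlen

/-- An operand read against a value list whose `j`-th entry has degree `≤ 2^(j+1)` for every `j`
has degree `≤ 2^(length)` (variables have degree `1`, constants and junk `0`). [folklore] -/
theorem totalDegree_operand_eval_le_of [Nontrivial R] {vals : List (MvPolynomial σ R)}
    (h : ∀ j, (vals.getD j 0).totalDegree ≤ 2 ^ (j + 1)) (u : Operand R σ) :
    (u.eval vals).totalDegree ≤ 2 ^ vals.length := by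
  cases u with
  | var i => simp [Operand.eval, Nat.one_le_two_pow]
  | const c => simp [Operand.eval]
  | gate j =>
    rw [Operand.eval_gate]
    by_cases hj : j < vals.length
    · exact (h j).trans (Nat.pow_le_pow_right two_pos hj)
    · rw [List.getD_eq_default _ _ (not_lt.mp hj)]
      simp

/-- **Degree growth**: in a fan-in-two gate list the value of gate `j` has total degree at most
`2^(j+1)` (junk positions carry `0`). [folklore] -/
theorem totalDegree_getD_gateValues_le [Nontrivial R] (gs : List (Gate R σ))
    (h2 : ∀ g ∈ gs, g.fanIn ≤ 2) (j : ℕ) :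
    ((gateValues gs).getD j 0).totalDegree ≤ 2 ^ (j + 1) := by
  induction gs using List.reverseRecOn generalizing j with
  | nil => simp [gateValues]
  | append_singleton gs g ih =>
    have h2' : ∀ g' ∈ gs, g'.fanIn ≤ 2 := fun g' hg' => h2 g' (List.mem_append_left _ hg')
    have hg : g.fanIn ≤ 2 := h2 g (by simp)
    rw [gateValues_append_singleton]
    have hlen : (gateValues gs).length = gs.length := gateValues_length gs
    rcases Nat.lt_trichotomy j gs.length with hj | rfl | hj
    · rw [List.getD_append _ _ _ _ (hlen ▸ hj)]
      exact ih h2' j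
    · rw [List.getD_append_right _ _ _ _ hlen.le, hlen, Nat.sub_self, List.getD_cons_zero,
        pow_succ, mul_comm]
      refine totalDegree_gate_eval_le hg fun u _ => ?_
      exact hlen ▸ totalDegree_operand_eval_le_of (ih h2') u
    · rw [List.getD_eq_default _ _ (by simp [hlen]; omega)]
      simp

/-- **Operands are `2^s`-bounded in degree** after `s` fan-in-two gates. [folklore] -/
theorem totalDegree_operand_eval_le [Nontrivial R] (gs : List (Gate R σ))
    (h2 : ∀ g ∈ gs, g.fanIn ≤ 2) (u : Operand R σ) :
    (u.eval (gateValues gs)).totalDegree ≤ 2 ^ gs.length := by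
  have h := totalDegree_operand_eval_le_of (totalDegree_getD_gateValues_le gs h2) u
  rwa [gateValues_length] at h

end JssContraction

/-- **Registered sub-goal `stub_jssContraction_partA` of stub `stub_jssContraction`** (part A in
closed form): the sum-gate rule of the Jukna–Seiwert–Sergeev contraction over `ℝ≥0`,
`[c p + d q] = c x^{gcd p - g} [p] + d x^{gcd q - g} [q]` with `g = gcd (c p + d q)`
(Jukna 2023, Claim 6.17) — `JssContraction.contract_add_smul`. [folklore] -/
theorem stub_jssContraction_partA :
    ∀ (σ : Type) (c d : ℝ≥0) (p q : MvPolynomial σ ℝ≥0),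
      JssContraction.contract (c • p + d • q) =
        c • (monomial (JssContraction.gcdVec p - JssContraction.gcdVec (c • p + d • q)) 1 *
          JssContraction.contract p) +
        d • (monomial (JssContraction.gcdVec q - JssContraction.gcdVec (c • p + d • q)) 1 *
          JssContraction.contract q) :=
  fun _ c d p q => JssContraction.contract_add_smul c d p q

end Summit.ValiantsHypothesis.ValiantsHypothesis.Theorems.DivisionGapPerDivisionHard

end
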